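import Summits.Parity.GeneralizedHardyLittlewood.Theorems.LeeYangFibresHyperbolicityClipsParityNewton
import Summits.Parity.GeneralizedHardyLittlewood.Theorems.LeeYangFibresHyperbolicityClipsParityInterp
import Summits.Parity.GeneralizedHardyLittlewood.Theorems.LeeYangFibresHyperbolicityClipsParityFibreAlgebra

/-!
# Route `LeeYangFibres`, support `HyperbolicityClipsParity` (stmt-Parity-14114): the fibre clipping lemma

Helper file 4/·. For ONE scale `N`, system and body — i.e. for fixed cell data `C_j ≥ 0`
(`j ∈ [1,u]^t`), Walsh amplitudes `θ_S` (`|θ_S| ≤ 2`), model densities `a_n ≥ 0` and main-term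
scale `M > 0` with `|C_j - W_θ(j) M ∏_k a_{j_k}| ≤ E₀` (the cell-parity law), and a coordinate
`i` all of whose fibre polynomials `ζ ↦ ∑_j C_j ζ^{j_i} ∏_{k ≠ i} w_k^{j_k}` (`w ∈ (0,1]^t`) are
real-rooted (fibre hyperbolicity) — we prove:

* `beta_bound`: for every frozen `w`, the odd part `β(w) = ∑_{T ⊆ U} θ_{T ∪ {i}} ∏_{k ∈ U} G_T(k,w_k)`
  of the fibre main term is clipped, `|β(w)| ≤ (2^t δ + ε') ∏_{k ∈ U} F(w_k)`, where `δ` is the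
  log-concavity margin of the model at an odd and an even bulk index and `ε'` measures `E₀`
  against the main term (Newton at the two bulk indices, `clip_abs_sub_le`);
* `fibre_clip`: frozen fugacities in `{a₁/3, 1}` realise the grid `{ρ(a₁/3), ρ(1)}^U`, `ρ = F̃/F`
  (`ρ(a₁/3) ≥ 1/2`, `|ρ(1)| ≤ 1/4` by parity balance); interpolation gives
  `|θ_{T ∪ {i}}| ≤ 8^{t-1} (2^t δ + ε')`. No named facts are used.
-/

namespace Summit.Parity.GeneralizedHardyLittlewood.Theorems.HyperbolicityClipsParity

open Finset

/-! ## The fibre polynomial: real roots, Newton, decomposition, error -/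

/-- The fibre polynomial of `FibreHyperbolicity` is `∑_j (C_j ∏_{k ≠ i} w_k^{j_k}) ζ^{j_i}`. -/
theorem fibre_roots_real {t u : ℕ} (i : Fin t) (C : (Fin t → ℕ) → ℝ) (w : Fin t → ℝ)
    (hhyp : ∀ z : ℂ, (∑ j ∈ Fintype.piFinset (fun _ : Fin t => Finset.Icc 1 u),
      (C j : ℂ) * ∏ k, (if k = i then z else ((w k : ℝ) : ℂ)) ^ (j k)) = 0 → z.im = 0) :
    ∀ z : ℂ, (∑ j ∈ Fintype.piFinset (fun _ : Fin t => Finset.Icc 1 u),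
      ((C j * ∏ k ∈ Finset.univ.erase i, w k ^ (j k) : ℝ) : ℂ) * z ^ (j i)) = 0 → z.im = 0 := by
  intro z hz
  apply hhyp z
  rw [← hz]
  refine Finset.sum_congr rfl fun j _ => ?_
  rw [← Finset.mul_prod_erase Finset.univ _ (Finset.mem_univ i), if_pos rfl]
  have : ∏ k ∈ Finset.univ.erase i, (if k = i then z else ((w k : ℝ) : ℂ)) ^ (j k) =
      ∏ k ∈ Finset.univ.erase i, ((w k : ℝ) : ℂ) ^ (j k) :=
    Finset.prod_congr rfl fun k hk => by rw [if_neg (Finset.ne_of_mem_erase hk)]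
  rw [this]
  push_cast
  ring

/-- **Newton on a fibre**: the fibre coefficients `p_m = ∑_{j_i = m} C_j ∏_{k ≠ i} w_k^{j_k}`
satisfy `p_k p_{k+2} ≤ p_{k+1}²`. -/
theorem fibre_newton {t u : ℕ} (i : Fin t) (C : (Fin t → ℕ) → ℝ) (hC : ∀ j, 0 ≤ C j)
    (w : Fin t → ℝ) (hw : ∀ k, 0 < w k ∧ w k ≤ 1)
    (hhyp : ∀ z : ℂ, (∑ j ∈ Fintype.piFinset (fun _ : Fin t => Finset.Icc 1 u),
      (C j : ℂ) * ∏ k, (if k = i then z else ((w k : ℝ) : ℂ)) ^ (j k)) = 0 → z.im = 0) (k : ℕ) :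
    (∑ j ∈ (Fintype.piFinset fun _ : Fin t => Finset.Icc 1 u).filter (fun j => j i = k),
        C j * ∏ l ∈ Finset.univ.erase i, w l ^ (j l)) *
      (∑ j ∈ (Fintype.piFinset fun _ : Fin t => Finset.Icc 1 u).filter (fun j => j i = k + 2),
        C j * ∏ l ∈ Finset.univ.erase i, w l ^ (j l)) ≤
      (∑ j ∈ (Fintype.piFinset fun _ : Fin t => Finset.Icc 1 u).filter (fun j => j i = k + 1),
        C j * ∏ l ∈ Finset.univ.erase i, w l ^ (j l)) ^ 2 :=
  newton_filter_sum_sq _ (fun j => C j * ∏ l ∈ Finset.univ.erase i, w l ^ (j l)) (fun j => j i)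
    (fun j _ => mul_nonneg (hC j) (Finset.prod_nonneg fun l _ => pow_nonneg (hw l).1.le _))
    (fibre_roots_real i C w hhyp) k

/-- **Decomposition of a fibre coefficient**: `p_m = M a_m (α + (-1)^{m+1} β) + e_m`, `e_m` the
fibre sum of the law's errors. -/
theorem fibre_decomp {t u : ℕ} (i : Fin t) {m : ℕ} (hm : m ∈ Finset.Icc 1 u)
    (θ : Finset (Fin t) → ℝ) (a : ℕ → ℝ) (w : Fin t → ℝ) (M : ℝ) (C : (Fin t → ℕ) → ℝ) :
    ∑ j ∈ (Fintype.piFinset fun _ : Fin t => Finset.Icc 1 u).filter (fun j => j i = m),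
        C j * ∏ k ∈ Finset.univ.erase i, w k ^ (j k) =
      M * a m *
        ((∑ T ∈ (Finset.univ.erase i).powerset, θ T * ∏ k ∈ Finset.univ.erase i,
            ∑ n ∈ Finset.Icc 1 u, (if k ∈ T then (-1 : ℝ) ^ (n + 1) else 1) * a n * w k ^ n) +
         (-1 : ℝ) ^ (m + 1) *
          ∑ T ∈ (Finset.univ.erase i).powerset, θ (insert i T) * ∏ k ∈ Finset.univ.erase i,
            ∑ n ∈ Finset.Icc 1 u, (if k ∈ T then (-1 : ℝ) ^ (n + 1) else 1) * a n * w k ^ n) +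
      ∑ j ∈ (Fintype.piFinset fun _ : Fin t => Finset.Icc 1 u).filter (fun j => j i = m),
        (C j - (∑ S : Finset (Fin t), θ S * ∏ k ∈ S, (-1 : ℝ) ^ (j k + 1)) * (M * ∏ k, a (j k))) *
          ∏ k ∈ Finset.univ.erase i, w k ^ (j k) := by
  rw [← fibre_mainTerm i hm θ a w M, ← Finset.sum_add_distrib]
  exact Finset.sum_congr rfl fun j _ => by ring

/-- **The fibre error**: `|e_m| ≤ E₀ u^{#U} ∏_{k ∈ U} w_k`. -/
theorem fibre_err {t u : ℕ} (i : Fin t) {m : ℕ} (hm : m ∈ Finset.Icc 1 u)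
    (θ : Finset (Fin t) → ℝ) (a : ℕ → ℝ) (w : Fin t → ℝ) (hw : ∀ k, 0 < w k ∧ w k ≤ 1) (M : ℝ)
    (C : (Fin t → ℕ) → ℝ) {E₀ : ℝ} (hE₀ : 0 ≤ E₀)
    (hlaw : ∀ j ∈ Fintype.piFinset (fun _ : Fin t => Finset.Icc 1 u),
      |C j - (∑ S : Finset (Fin t), θ S * ∏ k ∈ S, (-1 : ℝ) ^ (j k + 1)) * (M * ∏ k, a (j k))| ≤ E₀) :
    |∑ j ∈ (Fintype.piFinset fun _ : Fin t => Finset.Icc 1 u).filter (fun j => j i = m),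
        (C j - (∑ S : Finset (Fin t), θ S * ∏ k ∈ S, (-1 : ℝ) ^ (j k + 1)) * (M * ∏ k, a (j k))) *
          ∏ k ∈ Finset.univ.erase i, w k ^ (j k)| ≤
      E₀ * (u : ℝ) ^ (Finset.univ.erase i).card * ∏ k ∈ Finset.univ.erase i, w k := by
  have hwn : ∀ j : Fin t → ℕ, 0 ≤ ∏ k ∈ Finset.univ.erase i, w k ^ (j k) :=
    fun j => Finset.prod_nonneg fun k _ => pow_nonneg (hw k).1.le _
  calc |∑ j ∈ (Fintype.piFinset fun _ : Fin t => Finset.Icc 1 u).filter (fun j => j i = m),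
        (C j - (∑ S : Finset (Fin t), θ S * ∏ k ∈ S, (-1 : ℝ) ^ (j k + 1)) * (M * ∏ k, a (j k))) *
          ∏ k ∈ Finset.univ.erase i, w k ^ (j k)|
      ≤ ∑ j ∈ (Fintype.piFinset fun _ : Fin t => Finset.Icc 1 u).filter (fun j => j i = m),
          |(C j - (∑ S : Finset (Fin t), θ S * ∏ k ∈ S, (-1 : ℝ) ^ (j k + 1)) * (M * ∏ k, a (j k))) *
            ∏ k ∈ Finset.univ.erase i, w k ^ (j k)| := Finset.abs_sum_le_sum_abs _ _
    _ ≤ ∑ j ∈ (Fintype.piFinset fun _ : Fin t => Finset.Icc 1 u).filter (fun j => j i = m),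
          E₀ * ∏ k ∈ Finset.univ.erase i, w k ^ (j k) := by
        refine Finset.sum_le_sum fun j hj => ?_
        rw [abs_mul, abs_of_nonneg (hwn j)]
        exact mul_le_mul_of_nonneg_right (hlaw j (Finset.mem_filter.1 hj).1) (hwn j)
    _ = E₀ * ∏ k ∈ Finset.univ.erase i, ∑ n ∈ Finset.Icc 1 u, w k ^ n := by
        rw [← Finset.mul_sum, fibre_weightSum i hm w]
    _ ≤ E₀ * ((u : ℝ) ^ (Finset.univ.erase i).card * ∏ k ∈ Finset.univ.erase i, w k) :=
        mul_le_mul_of_nonneg_left (prod_geomWeight_le _ fun k => ⟨(hw k).1.le, (hw k).2⟩) hE₀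
    _ = _ := by ring

/-- **The fibre scale dominates the weights**: `a₁^{#U} ∏_{k ∈ U} w_k ≤ ∏_{k ∈ U} F(w_k)`. -/
theorem fibre_scale_lower {t u : ℕ} (U : Finset (Fin t)) (hu : 1 ≤ u) {a : ℕ → ℝ}
    (ha : ∀ n, 0 ≤ a n) (w : Fin t → ℝ) (hw : ∀ k, 0 < w k ∧ w k ≤ 1) :
    a 1 ^ U.card * ∏ k ∈ U, w k ≤ ∏ k ∈ U, ∑ n ∈ Finset.Icc 1 u, a n * w k ^ n := by
  rw [Finset.pow_card_mul_prod]
  exact Finset.prod_le_prod (fun k _ => mul_nonneg (ha 1) (hw k).1.le)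
    fun k _ => a_one_mul_le_F hu ha (hw k).1.le

/-- **Walsh sums against the fibre scale**: `|∑_{T ⊆ U} θ'_T ∏_{k ∈ U} G_T(k, w_k)| ≤ 2·2^{#U} ∏_{k ∈ U} F(w_k)`
for `|θ'| ≤ 2`. -/
theorem fibre_walsh_bound {t u : ℕ} (U : Finset (Fin t)) (θ' : Finset (Fin t) → ℝ)
    (hθ : ∀ T, |θ' T| ≤ 2) {a : ℕ → ℝ} (ha : ∀ n, 0 ≤ a n) (w : Fin t → ℝ) (hw : ∀ k, 0 ≤ w k) :
    |∑ T ∈ U.powerset, θ' T * ∏ k ∈ U,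
        ∑ n ∈ Finset.Icc 1 u, (if k ∈ T then (-1 : ℝ) ^ (n + 1) else 1) * a n * w k ^ n| ≤
      2 * 2 ^ U.card * ∏ k ∈ U, ∑ n ∈ Finset.Icc 1 u, a n * w k ^ n := by
  calc |∑ T ∈ U.powerset, θ' T * ∏ k ∈ U,
        ∑ n ∈ Finset.Icc 1 u, (if k ∈ T then (-1 : ℝ) ^ (n + 1) else 1) * a n * w k ^ n|
      ≤ ∑ T ∈ U.powerset, |θ' T * ∏ k ∈ U,
          ∑ n ∈ Finset.Icc 1 u, (if k ∈ T then (-1 : ℝ) ^ (n + 1) else 1) * a n * w k ^ n| :=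
        Finset.abs_sum_le_sum_abs _ _
    _ ≤ ∑ T ∈ U.powerset, 2 * ∏ k ∈ U, ∑ n ∈ Finset.Icc 1 u, a n * w k ^ n := by
        refine Finset.sum_le_sum fun T _ => ?_
        rw [abs_mul, Finset.abs_prod]
        exact mul_le_mul (hθ T) (Finset.prod_le_prod (fun k _ => abs_nonneg _)
          fun k _ => abs_G_le_F T k ha (hw k)) (Finset.prod_nonneg fun k _ => abs_nonneg _)
          (by norm_num)
    _ = 2 * 2 ^ U.card * ∏ k ∈ U, ∑ n ∈ Finset.Icc 1 u, a n * w k ^ n := by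
        rw [Finset.sum_const, Finset.card_powerset, nsmul_eq_mul]; push_cast; ring

/-- Normalisation of one fibre coefficient: from `p = M a (main) + e`, `|e| ≤ E₀ u^{t-1} W`,
`E₀ u^{t-1} ≤ ε' M a a₁^{t-1}` and `a₁^{t-1} W ≤ Π` we get `|p/(M a) - main| ≤ ε' Π` (and
`p/(M a) ≥ 0` when `p ≥ 0`). -/
theorem fibre_normalise {p M am main e E₀ ut W ε' a1t PiF : ℝ} (hM : 0 < M) (ham : 0 < am)
    (hp : p = M * am * main + e) (he : |e| ≤ E₀ * ut * W) (hW : 0 ≤ W)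
    (hsmall : E₀ * ut ≤ ε' * (M * am) * a1t) (hPi : a1t * W ≤ PiF) (hε' : 0 ≤ ε') (hp0 : 0 ≤ p) :
    |p / (M * am) - main| ≤ ε' * PiF ∧ 0 ≤ p / (M * am) := by
  have hMa : 0 < M * am := mul_pos hM ham
  refine ⟨?_, div_nonneg hp0 hMa.le⟩
  have hq : p / (M * am) - main = e / (M * am) := by
    rw [hp]; field_simp; ring
  rw [hq, abs_div, abs_of_pos hMa, div_le_iff₀ hMa]
  calc |e| ≤ E₀ * ut * W := he
    _ ≤ ε' * (M * am) * a1t * W := mul_le_mul_of_nonneg_right hsmall hW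
    _ = ε' * (M * am) * (a1t * W) := by ring
    _ ≤ ε' * (M * am) * PiF := mul_le_mul_of_nonneg_left hPi (by positivity)
    _ = ε' * PiF * (M * am) := by ring

/-- Normalisation of Newton's inequality: `pm1 pp1 ≤ p0²`, `p_· = M a_· P_·`, `P₋, P₊ ≥ 0` and the
margin `(1-δ) a0² ≤ am1 ap1` give `(1-δ) P₋ P₊ ≤ P₀²`. -/
theorem newton_normalise {M am1 a0 ap1 pm1 p0 pp1 δ : ℝ} (hM : 0 < M) (ham1 : 0 < am1) (ha0 : 0 < a0)
    (hap1 : 0 < ap1) (hN : pm1 * pp1 ≤ p0 ^ 2) (hPm : 0 ≤ pm1 / (M * am1))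
    (hPp : 0 ≤ pp1 / (M * ap1)) (hmargin : (1 - δ) * a0 ^ 2 ≤ am1 * ap1) :
    (1 - δ) * (pm1 / (M * am1) * (pp1 / (M * ap1))) ≤ (p0 / (M * a0)) ^ 2 := by
  have hPP : 0 ≤ pm1 / (M * am1) * (pp1 / (M * ap1)) := mul_nonneg hPm hPp
  have h1 : (1 - δ) * a0 ^ 2 * (pm1 / (M * am1) * (pp1 / (M * ap1))) ≤
      am1 * ap1 * (pm1 / (M * am1) * (pp1 / (M * ap1))) :=
    mul_le_mul_of_nonneg_right hmargin hPP
  have h2 : am1 * ap1 * (pm1 / (M * am1) * (pp1 / (M * ap1))) = pm1 * pp1 / M ^ 2 := by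
    field_simp
  have h3 : (p0 / (M * a0)) ^ 2 = p0 ^ 2 / M ^ 2 / a0 ^ 2 := by
    field_simp
  have h4 : pm1 * pp1 / M ^ 2 ≤ p0 ^ 2 / M ^ 2 := div_le_div_of_nonneg_right hN (by positivity)
  rw [h3, le_div_iff₀ (by positivity)]
  calc (1 - δ) * (pm1 / (M * am1) * (pp1 / (M * ap1))) * a0 ^ 2
      = (1 - δ) * a0 ^ 2 * (pm1 / (M * am1) * (pp1 / (M * ap1))) := by ring
    _ ≤ pm1 * pp1 / M ^ 2 := h1.trans_eq h2
    _ ≤ p0 ^ 2 / M ^ 2 := h4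

/-- Sign bookkeeping: `(-1)^{n+1} = 1` for odd `n`. -/
theorem neg_one_pow_succ_of_odd {n : ℕ} (h : Odd n) : (-1 : ℝ) ^ (n + 1) = 1 := by
  rw [pow_succ, h.neg_one_pow]; norm_num

/-- Sign bookkeeping: `(-1)^{n+1} = -1` for even `n`. -/
theorem neg_one_pow_succ_of_even {n : ℕ} (h : Even n) : (-1 : ℝ) ^ (n + 1) = -1 := by
  rw [pow_succ, h.neg_one_pow]; norm_num

/-! ## Clipping the odd part of a fibre -/

/-- **Clipping the odd part of one fibre.** For frozen fugacities `w ∈ (0,1]^t` (the `i`-th is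
ignored), the odd Walsh part `β(w)` of the fibre main term satisfies
`|β(w)| ≤ (2^t δ + ε') · ∏_{k ≠ i} F(w_k)`: the six normalised fibre coefficients around the odd
bulk index `j₁` and the even one `j₂` are `ε' Π`-close to `α ± β` (law + `hsmall`), non-negative,
and log-concave with margin `δ` (Newton on the real-rooted fibre polynomial + model margins), so
`clip_abs_sub_le` applies with `B = 2^{t+1} Π`. -/
theorem beta_bound {t u : ℕ} (i : Fin t) (hu : 1 ≤ u)
    (θ : Finset (Fin t) → ℝ) (hθ : ∀ S, |θ S| ≤ 2)
    (a : ℕ → ℝ) (ha : ∀ n, 0 ≤ a n)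
    {j₁ j₂ : ℕ} (hj₁ : Odd j₁) (hj₂ : Even j₂) (h2j₁ : 2 ≤ j₁) (hj₁u : j₁ + 1 ≤ u)
    (h2j₂ : 2 ≤ j₂) (hj₂u : j₂ + 1 ≤ u)
    (hapos : ∀ m ∈ ({j₁ - 1, j₁, j₁ + 1, j₂ - 1, j₂, j₂ + 1} : Finset ℕ), 0 < a m)
    {δ : ℝ} (hδ0 : 0 ≤ δ) (hδ1 : δ ≤ 1)
    (hmargin : ∀ m ∈ ({j₁, j₂} : Finset ℕ), (1 - δ) * a m ^ 2 ≤ a (m - 1) * a (m + 1))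
    (C : (Fin t → ℕ) → ℝ) (hC : ∀ j, 0 ≤ C j) {M : ℝ} (hM : 0 < M) {E₀ : ℝ} (hE₀ : 0 ≤ E₀)
    (hlaw : ∀ j ∈ Fintype.piFinset (fun _ : Fin t => Finset.Icc 1 u),
      |C j - (∑ S : Finset (Fin t), θ S * ∏ k ∈ S, (-1 : ℝ) ^ (j k + 1)) * (M * ∏ k, a (j k))| ≤ E₀)
    (w : Fin t → ℝ) (hw : ∀ k, 0 < w k ∧ w k ≤ 1)
    (hhyp : ∀ z : ℂ, (∑ j ∈ Fintype.piFinset (fun _ : Fin t => Finset.Icc 1 u),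
      (C j : ℂ) * ∏ k, (if k = i then z else ((w k : ℝ) : ℂ)) ^ (j k)) = 0 → z.im = 0)
    {ε' : ℝ} (hε' : 0 ≤ ε')
    (hsmall : ∀ m ∈ ({j₁ - 1, j₁, j₁ + 1, j₂ - 1, j₂, j₂ + 1} : Finset ℕ),
      E₀ * (u : ℝ) ^ (t - 1) ≤ ε' * (M * a m) * a 1 ^ (t - 1)) :
    |∑ T ∈ (Finset.univ.erase i).powerset, θ (insert i T) * ∏ k ∈ Finset.univ.erase i,
        ∑ n ∈ Finset.Icc 1 u, (if k ∈ T then (-1 : ℝ) ^ (n + 1) else 1) * a n * w k ^ n| ≤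
      (2 ^ t * δ + ε') * ∏ k ∈ Finset.univ.erase i, ∑ n ∈ Finset.Icc 1 u, a n * w k ^ n := by
  have ht : t - 1 + 1 = t := Nat.sub_add_cancel (Nat.succ_le_of_lt i.pos)
  have hcard : (Finset.univ.erase i).card = t - 1 := by
    rw [Finset.card_erase_of_mem (Finset.mem_univ i), Finset.card_univ, Fintype.card_fin]
  have hI : ∀ m ∈ ({j₁ - 1, j₁, j₁ + 1, j₂ - 1, j₂, j₂ + 1} : Finset ℕ), m ∈ Finset.Icc 1 u := by
    intro m hm
    simp only [Finset.mem_insert, Finset.mem_singleton] at hm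
    rw [Finset.mem_Icc]; omega
  -- scale and Walsh bounds
  have hW0 : 0 ≤ ∏ k ∈ Finset.univ.erase i, w k := Finset.prod_nonneg fun k _ => (hw k).1.le
  have hscale := fibre_scale_lower (Finset.univ.erase i) hu ha w hw
  have hαb := fibre_walsh_bound (u := u) (Finset.univ.erase i) θ (fun T => hθ T) ha w
    (fun k => (hw k).1.le)
  have hβb := fibre_walsh_bound (u := u) (Finset.univ.erase i) (fun T => θ (insert i T))
    (fun T => hθ _) ha w (fun k => (hw k).1.le)
  rw [hcard] at hscale hαb hβb
  -- the six normalised coefficients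
  have key : ∀ m ∈ ({j₁ - 1, j₁, j₁ + 1, j₂ - 1, j₂, j₂ + 1} : Finset ℕ),
      |(∑ j ∈ (Fintype.piFinset fun _ : Fin t => Finset.Icc 1 u).filter (fun j => j i = m),
          C j * ∏ k ∈ Finset.univ.erase i, w k ^ (j k)) / (M * a m) -
        ((∑ T ∈ (Finset.univ.erase i).powerset, θ T * ∏ k ∈ Finset.univ.erase i,
            ∑ n ∈ Finset.Icc 1 u, (if k ∈ T then (-1 : ℝ) ^ (n + 1) else 1) * a n * w k ^ n) +
         (-1 : ℝ) ^ (m + 1) *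
          ∑ T ∈ (Finset.univ.erase i).powerset, θ (insert i T) * ∏ k ∈ Finset.univ.erase i,
            ∑ n ∈ Finset.Icc 1 u, (if k ∈ T then (-1 : ℝ) ^ (n + 1) else 1) * a n * w k ^ n)| ≤
        ε' * ∏ k ∈ Finset.univ.erase i, ∑ n ∈ Finset.Icc 1 u, a n * w k ^ n ∧
      0 ≤ (∑ j ∈ (Fintype.piFinset fun _ : Fin t => Finset.Icc 1 u).filter (fun j => j i = m),
          C j * ∏ k ∈ Finset.univ.erase i, w k ^ (j k)) / (M * a m) := by
    intro m hm
    refine fibre_normalise hM (hapos m hm) (fibre_decomp i (hI m hm) θ a w M C) ?_ hW0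
      (hsmall m hm) hscale hε' ?_
    · have := fibre_err i (hI m hm) θ a w hw M C hE₀ hlaw
      rwa [hcard] at this
    · exact Finset.sum_nonneg fun j _ => mul_nonneg (hC j)
        (Finset.prod_nonneg fun k _ => pow_nonneg (hw k).1.le _)
  -- Newton at `j₁ - 1` and `j₂ - 1`
  have hN₁ := fibre_newton i C hC w hw hhyp (j₁ - 1)
  have hN₂ := fibre_newton i C hC w hw hhyp (j₂ - 1)
  rw [show j₁ - 1 + 2 = j₁ + 1 by omega, show j₁ - 1 + 1 = j₁ by omega] at hN₁
  rw [show j₂ - 1 + 2 = j₂ + 1 by omega, show j₂ - 1 + 1 = j₂ by omega] at hN₂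
  obtain ⟨k₁, p₁⟩ := key (j₁ - 1) (by simp)
  obtain ⟨k₂, p₂⟩ := key j₁ (by simp)
  obtain ⟨k₃, p₃⟩ := key (j₁ + 1) (by simp)
  obtain ⟨k₄, p₄⟩ := key (j₂ - 1) (by simp)
  obtain ⟨k₅, p₅⟩ := key j₂ (by simp)
  obtain ⟨k₆, p₆⟩ := key (j₂ + 1) (by simp)
  -- signs
  have s₁ : (-1 : ℝ) ^ (j₁ - 1 + 1) = -1 := by
    rw [Nat.sub_add_cancel (by omega : 1 ≤ j₁)]; exact hj₁.neg_one_pow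
  have s₂ : (-1 : ℝ) ^ (j₁ + 1) = 1 := neg_one_pow_succ_of_odd hj₁
  have s₃ : (-1 : ℝ) ^ (j₁ + 1 + 1) = -1 := neg_one_pow_succ_of_even (hj₁.add_odd odd_one)
  have s₄ : (-1 : ℝ) ^ (j₂ - 1 + 1) = 1 := by
    rw [Nat.sub_add_cancel (by omega : 1 ≤ j₂)]; exact hj₂.neg_one_pow
  have s₅ : (-1 : ℝ) ^ (j₂ + 1) = -1 := neg_one_pow_succ_of_even hj₂
  have s₆ : (-1 : ℝ) ^ (j₂ + 1 + 1) = 1 := neg_one_pow_succ_of_odd (hj₂.add_odd odd_one)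
  rw [s₁] at k₁; rw [s₂] at k₂; rw [s₃] at k₃; rw [s₄] at k₄; rw [s₅] at k₅; rw [s₆] at k₆
  -- normalised Newton
  have hN₁' := newton_normalise hM (hapos (j₁ - 1) (by simp)) (hapos j₁ (by simp))
    (hapos (j₁ + 1) (by simp)) hN₁ p₁ p₃ (hmargin j₁ (by simp))
  have hN₂' := newton_normalise hM (hapos (j₂ - 1) (by simp)) (hapos j₂ (by simp))
    (hapos (j₂ + 1) (by simp)) hN₂ p₄ p₆ (hmargin j₂ (by simp))
  -- abbreviate and clip
  set PiF := ∏ k ∈ Finset.univ.erase i, ∑ n ∈ Finset.Icc 1 u, a n * w k ^ n with hPiF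
  set α := ∑ T ∈ (Finset.univ.erase i).powerset, θ T * ∏ k ∈ Finset.univ.erase i,
    ∑ n ∈ Finset.Icc 1 u, (if k ∈ T then (-1 : ℝ) ^ (n + 1) else 1) * a n * w k ^ n with hα
  set β := ∑ T ∈ (Finset.univ.erase i).powerset, θ (insert i T) * ∏ k ∈ Finset.univ.erase i,
    ∑ n ∈ Finset.Icc 1 u, (if k ∈ T then (-1 : ℝ) ^ (n + 1) else 1) * a n * w k ^ n with hβ
  rw [show α + (1 : ℝ) * β = α + β by ring] at k₂ k₄ k₆
  rw [show α + (-1 : ℝ) * β = α - β by ring] at k₁ k₃ k₅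
  have hPiF0 : 0 ≤ PiF := le_trans (mul_nonneg (pow_nonneg (ha 1) _) hW0) hscale
  have hX : |α + β| ≤ 4 * 2 ^ (t - 1) * PiF := (abs_add_le _ _).trans (by linarith)
  have hY : |α - β| ≤ 4 * 2 ^ (t - 1) * PiF := (abs_sub _ _).trans (by linarith)
  have hclip := clip_abs_sub_le (e := ε' * PiF) (B := 4 * 2 ^ (t - 1) * PiF) hδ0 hδ1
    (mul_nonneg hε' hPiF0) hX hY k₂ k₁ k₃ k₅ k₄ k₆ p₂ p₅ hN₁' hN₂'
  rw [show α + β - (α - β) = 2 * β by ring, abs_mul, abs_two] at hclip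
  have h2t : (2 : ℝ) ^ t = 2 * 2 ^ (t - 1) := by
    conv_lhs => rw [← ht, pow_succ]
    ring
  rw [h2t]
  nlinarith [hclip]

/-! ## The clipping lemma on the grid -/

/-- **Every amplitude through `i` is clipped.** With all fibres through `i` hyperbolic, the
frozen fugacities `w_k ∈ {a₁/3, 1}` realise the two-point grid `{ρ(a₁/3), ρ(1)}^U`
(`ρ = F̃/F ∈ [-1,1]`, `ρ(a₁/3) ≥ 1/2`, `|ρ(1)| ≤ 1/4` by parity balance) on which the multiaffine
form `∑_{T ⊆ U} θ_{T ∪ {i}} ∏_{k ∈ T} ρ_k = β/Π` is bounded by `2^t δ + ε'` (`beta_bound`);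
interpolation (`multiaffine_coeff_bound`, `d = 1/4`) gives `|θ_{T ∪ {i}}| ≤ 8^{t-1}(2^t δ + ε')`. -/
theorem fibre_clip {t u : ℕ} (i : Fin t) (hu : 1 ≤ u)
    (θ : Finset (Fin t) → ℝ) (hθ : ∀ S, |θ S| ≤ 2)
    (a : ℕ → ℝ) (ha : ∀ n, 0 ≤ a n) (ha1 : 0 < a 1) (hsum : ∑ n ∈ Finset.Icc 1 u, a n ≤ 1)
    {εb : ℝ} (hεb : εb ≤ 1 / 4)
    (hbal : |∑ n ∈ Finset.Icc 1 u, (-1 : ℝ) ^ (n + 1) * a n| ≤ εb * ∑ n ∈ Finset.Icc 1 u, a n)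
    {j₁ j₂ : ℕ} (hj₁ : Odd j₁) (hj₂ : Even j₂) (h2j₁ : 2 ≤ j₁) (hj₁u : j₁ + 1 ≤ u)
    (h2j₂ : 2 ≤ j₂) (hj₂u : j₂ + 1 ≤ u)
    (hapos : ∀ m ∈ ({j₁ - 1, j₁, j₁ + 1, j₂ - 1, j₂, j₂ + 1} : Finset ℕ), 0 < a m)
    {δ : ℝ} (hδ0 : 0 ≤ δ) (hδ1 : δ ≤ 1)
    (hmargin : ∀ m ∈ ({j₁, j₂} : Finset ℕ), (1 - δ) * a m ^ 2 ≤ a (m - 1) * a (m + 1))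
    (C : (Fin t → ℕ) → ℝ) (hC : ∀ j, 0 ≤ C j) {M : ℝ} (hM : 0 < M) {E₀ : ℝ} (hE₀ : 0 ≤ E₀)
    (hlaw : ∀ j ∈ Fintype.piFinset (fun _ : Fin t => Finset.Icc 1 u),
      |C j - (∑ S : Finset (Fin t), θ S * ∏ k ∈ S, (-1 : ℝ) ^ (j k + 1)) * (M * ∏ k, a (j k))| ≤ E₀)
    (hhyp : ∀ w : Fin t → ℝ, (∀ k, 0 < w k ∧ w k ≤ 1) → ∀ z : ℂ,
      (∑ j ∈ Fintype.piFinset (fun _ : Fin t => Finset.Icc 1 u),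
        (C j : ℂ) * ∏ k, (if k = i then z else ((w k : ℝ) : ℂ)) ^ (j k)) = 0 → z.im = 0)
    {ε' : ℝ} (hε' : 0 ≤ ε')
    (hsmall : ∀ m ∈ ({j₁ - 1, j₁, j₁ + 1, j₂ - 1, j₂, j₂ + 1} : Finset ℕ),
      E₀ * (u : ℝ) ^ (t - 1) ≤ ε' * (M * a m) * a 1 ^ (t - 1)) :
    ∀ T ∈ (Finset.univ.erase i).powerset, |θ (insert i T)| ≤ 8 ^ (t - 1) * (2 ^ t * δ + ε') := by
  have hcard : (Finset.univ.erase i).card = t - 1 := by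
    rw [Finset.card_erase_of_mem (Finset.mem_univ i), Finset.card_univ, Fintype.card_fin]
  -- the two nodes
  obtain ⟨hF0pos, hF0le⟩ := node_estimate hu ha ha1 hsum
  have hF1 : ∑ n ∈ Finset.Icc 1 u, a n * (1 : ℝ) ^ n = ∑ n ∈ Finset.Icc 1 u, a n :=
    Finset.sum_congr rfl fun n _ => by rw [one_pow, mul_one]
  have hFt1 : ∑ n ∈ Finset.Icc 1 u, (-1 : ℝ) ^ (n + 1) * a n * (1 : ℝ) ^ n =
      ∑ n ∈ Finset.Icc 1 u, (-1 : ℝ) ^ (n + 1) * a n :=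
    Finset.sum_congr rfl fun n _ => by rw [one_pow, mul_one]
  have hF1pos : 0 < ∑ n ∈ Finset.Icc 1 u, a n * (1 : ℝ) ^ n := by
    have := a_one_mul_le_F hu ha (zero_le_one (α := ℝ))
    rw [mul_one] at this
    exact lt_of_lt_of_le ha1 this
  set n₀ : ℝ := (∑ n ∈ Finset.Icc 1 u, (-1 : ℝ) ^ (n + 1) * a n * (a 1 / 3) ^ n) /
    ∑ n ∈ Finset.Icc 1 u, a n * (a 1 / 3) ^ n with hn₀_def
  set n₁ : ℝ := (∑ n ∈ Finset.Icc 1 u, (-1 : ℝ) ^ (n + 1) * a n * (1 : ℝ) ^ n) /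
    ∑ n ∈ Finset.Icc 1 u, a n * (1 : ℝ) ^ n with hn₁_def
  have hn₀ : |n₀| ≤ 1 := by
    rw [hn₀_def, abs_div, abs_of_pos hF0pos, div_le_one hF0pos]
    exact abs_Ftilde_le_F ha (by positivity)
  have hn₁ : |n₁| ≤ 1 := by
    rw [hn₁_def, abs_div, abs_of_pos hF1pos, div_le_one hF1pos]
    exact abs_Ftilde_le_F ha zero_le_one
  have hn₀ge : 1 / 2 ≤ n₀ := by
    rw [hn₀_def, le_div_iff₀ hF0pos]; linarith
  have hn₁le : |n₁| ≤ 1 / 4 := by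
    rw [hn₁_def, abs_div, abs_of_pos hF1pos, div_le_iff₀ hF1pos, hF1, hFt1]
    exact hbal.trans (mul_le_mul_of_nonneg_right hεb (Finset.sum_nonneg fun n _ => ha n))
  have hsep : (1 / 4 : ℝ) ≤ |n₀ - n₁| := by
    have h := abs_le.1 hn₁le
    rw [abs_of_nonneg (by linarith)]
    linarith
  -- the grid bound
  have hgrid : ∀ x : Fin t → ℝ, (∀ k ∈ Finset.univ.erase i, x k = n₀ ∨ x k = n₁) →
      |∑ T ∈ (Finset.univ.erase i).powerset, θ (insert i T) * ∏ k ∈ T, x k| ≤ 2 ^ t * δ + ε' := by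
    intro x hx
    let w : Fin t → ℝ := fun k => if x k = n₀ then a 1 / 3 else 1
    have ha1le : a 1 ≤ 1 :=
      (Finset.single_le_sum (f := a) (fun n _ => ha n) (Finset.mem_Icc.2 ⟨le_refl 1, hu⟩)).trans hsum
    have hw : ∀ k, 0 < w k ∧ w k ≤ 1 := by
      intro k
      by_cases hxk : x k = n₀
      · have : w k = a 1 / 3 := if_pos hxk
        rw [this]; constructor <;> linarith
      · have : w k = 1 := if_neg hxk
        rw [this]; exact ⟨one_pos, le_rfl⟩
    have hβ := beta_bound i hu θ hθ a ha hj₁ hj₂ h2j₁ hj₁u h2j₂ hj₂u hapos hδ0 hδ1 hmargin C hC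
      hM hE₀ hlaw w hw (hhyp w hw) hε' hsmall
    have hFpos : ∀ k, 0 < ∑ n ∈ Finset.Icc 1 u, a n * w k ^ n := fun k =>
      lt_of_lt_of_le (mul_pos ha1 (hw k).1) (a_one_mul_le_F hu ha (hw k).1.le)
    have hρ : ∀ k ∈ Finset.univ.erase i, x k * ∑ n ∈ Finset.Icc 1 u, a n * w k ^ n =
        ∑ n ∈ Finset.Icc 1 u, (-1 : ℝ) ^ (n + 1) * a n * w k ^ n := by
      intro k hk
      by_cases hxk : x k = n₀
      · have hwk : w k = a 1 / 3 := if_pos hxk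
        rw [hwk, hxk, hn₀_def]; exact div_mul_cancel₀ _ hF0pos.ne'
      · have hwk : w k = 1 := if_neg hxk
        have hxk' : x k = n₁ := (hx k hk).resolve_left hxk
        rw [hwk, hxk', hn₁_def]; exact div_mul_cancel₀ _ hF1pos.ne'
    have hβeq : ∑ T ∈ (Finset.univ.erase i).powerset, θ (insert i T) * ∏ k ∈ Finset.univ.erase i,
        ∑ n ∈ Finset.Icc 1 u, (if k ∈ T then (-1 : ℝ) ^ (n + 1) else 1) * a n * w k ^ n =
        (∑ T ∈ (Finset.univ.erase i).powerset, θ (insert i T) * ∏ k ∈ T, x k) *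
          ∏ k ∈ Finset.univ.erase i, ∑ n ∈ Finset.Icc 1 u, a n * w k ^ n := by
      rw [Finset.sum_mul]
      refine Finset.sum_congr rfl fun T hT => ?_
      rw [prod_G_eq_prod_rho_mul (Finset.univ.erase i) T (Finset.mem_powerset.1 hT) a w x hρ]
      ring
    have hPipos : 0 < ∏ k ∈ Finset.univ.erase i, ∑ n ∈ Finset.Icc 1 u, a n * w k ^ n :=
      Finset.prod_pos fun k _ => hFpos k
    rw [hβeq, abs_mul, abs_of_pos hPipos] at hβ
    exact le_of_mul_le_mul_right hβ hPipos
  -- interpolation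
  intro T hT
  have h := multiaffine_coeff_bound (by norm_num : (0 : ℝ) < 1 / 4) hsep hn₀ hn₁ (2 ^ t * δ + ε')
    (Finset.univ.erase i) (fun T => θ (insert i T)) hgrid T hT
  rw [hcard, show (2 : ℝ) / (1 / 4) = 8 by norm_num] at h
  exact h

end Summit.Parity.GeneralizedHardyLittlewood.Theorems.HyperbolicityClipsParity
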